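import Summits.BirchSwinnertonDyer.BirchSwinnertonDyer.Theorems.ThetaPartnerAtTwoSignedKatoUpToAtTwoIwasawaInvolutionCompat
import Literature.NumberTheory.EllipticCurves.Kobayashi2003.CyclotomicTowerSignedSelmer
import Literature.NumberTheory.EllipticCurves.IwasawaAlgebraInvolution
import HarnessLib

/-!
# The η-TWIST LEMMA: `γ ↦ γ⁻¹` on Kobayashi's `η`-signed Pontryagin-dual data is the Iwasawa-involution twist
# (K8 `QuadraticBranchSignedControl`, Kato side print-exact; planner ruling T-Q73ι-2 «K8-IOTA», work order S2)

Cell `bsd-potss` (HOME `run/shared/lean/pub/bsd-potss/`), seat `bsd-potss-k8q-c2x` g10 (prover; lane B of the K8 Kato side).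
HONEST FRAMING: THEOREMS ONLY — no definition, no named fact, no instance, no `sorry`; ROUTE-FREE (no `Theses` import, outside the
K8 theses cone); closes no item; BSD is not proved by any of this; nothing is booked.

## What and why

The tree's `η`-signed dual data `Kobayashi2003.EtaSignedSelmerDualData W κ K₀ E η γ ε` (`X = Hom(Sel^ε(E/K_∞)^η, ℚ/ℤ)`, field
`toDual_T_smul`: `(T·x)(s) = x(conj_γ s) − x(s)`) let `T = γ − 1` act by PRE-composition with `conj_γ`, i.e. by print's
contragredient action of `γ⁻¹`; the print-exact `η`-zeta package `Kobayashi2003.thm62_63_73_etaColemanPoitouTate_zeta_contra`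
(p608027) is stated on the data over `γ⁻¹`. To move statements between the two conventions one needs, for `γ δ = 1`, a twin
`D′` over `δ` of every `D` over `γ` on the SAME character group with the `Λ`-structure twisted by `ι : T ↦ (1+T)⁻¹ − 1`, together
with the transport of the invariants: `char(D′.X) = ι(char(D.X))`, torsion ⟺ torsion, finite ⟺ finite, `ℓ_{ι𝔓}(D.X) = ℓ_𝔓(D′.X)`.
This is the `η`-component twin of the bsd-wall cell's `SignedKatoOffTwo.IwasawaInvolution.exists_twist_signedSelmerDualData_invol`
(K3, `p = 2`), built on the same engine (`…IwasawaInvolutionTwist` §1 abstract `ι`, `…SemilinearTransport`), with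
`Kobayashi2003.towerTopSubgroup κ K₀` in place of `κ.kerSubgroup` and `conjH1_mem_towerSignedSelmerInftyEta` for the stability
of the `η`-component. Contents: §1 `moduleFinite_[of|iff_of]_semilinear_equiv` (finite generation under a semilinear additive
isomorphism — the one invariant the bsd-wall package does not transport); §2 `eta_toDual_invol_one_add_X_smul`,
`exists_twist_etaSignedSelmerDualData[_invariants]` (abstract `ι`), **`exists_twist_etaSignedSelmerDualData_invol`** (the tree's
`IwasawaAlgebra.invol p` currency; the planner's sketch `EtaTwistLemma` clause for clause); §3 `ideal_map_invol_eq_comap`,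
`ideal_map_invol_map_invol` (`ι² = id` on ideals).

References: [Kobayashi2003] Def. 2.1 (p. 5), §4 p. 8 (the object `X^±(E/K_∞)^η`); [Greenberg1989] pp. 101–102 (`S^ι`);
[GreenbergLNM1716] §1 p. 60; [MazurTateTeitelbaum1986Invent] §I.17 (the involution); [Washington1997] §13.2.
-/

noncomputable section

-- justification: the `Summit.BirchSwinnertonDyer.BirchSwinnertonDyer.…` path repeats a component (route-file convention)
set_option linter.dupNamespace false
set_option autoImplicit false

open scoped Classical

namespace Summit.BirchSwinnertonDyer.BirchSwinnertonDyer.Theorems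

namespace KatoSideIotaContra

universe u v w x

/-! ## §1 Finite generation under a semilinear additive isomorphism -/

section Finite

variable {R : Type u} {S : Type v} [CommRing R] [CommRing S] (σ : R ≃+* S)
  {M : Type w} {N : Type x} [AddCommGroup M] [_root_.Module R M] [AddCommGroup N] [_root_.Module S N]
  (e : M ≃+ N)

/-- **Finite generation is transported by a `σ`-semilinear additive isomorphism** (`σ : R ≃+* S` a ring isomorphism):
the images of generators generate. [folklore] -/
theorem moduleFinite_of_semilinear_equiv (he : ∀ (r : R) (m : M), e (r • m) = σ r • e m)
    [Module.Finite R M] : Module.Finite S N := by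
  haveI : RingHomSurjective (σ : R →+* S) := ⟨σ.surjective⟩
  let f : M →ₛₗ[(σ : R →+* S)] N :=
    { toFun := e, map_add' := fun a b ↦ e.map_add a b, map_smul' := he }
  exact Module.Finite.of_surjective f e.surjective

/-- Iff form of `moduleFinite_of_semilinear_equiv` (the inverse isomorphism is `σ⁻¹`-semilinear). [folklore] -/
theorem moduleFinite_iff_of_semilinear_equiv (he : ∀ (r : R) (m : M), e (r • m) = σ r • e m) :
    Module.Finite R M ↔ Module.Finite S N := by
  refine ⟨fun _ ↦ moduleFinite_of_semilinear_equiv σ e he, fun _ ↦ ?_⟩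
  refine moduleFinite_of_semilinear_equiv σ.symm e.symm (fun s n ↦ ?_)
  apply e.injective
  rw [e.apply_symm_apply, he, σ.apply_symm_apply, e.apply_symm_apply]

end Finite

/-! ## §2 The η-twist lemma: `γ ↦ γ⁻¹` on `Kobayashi2003.EtaSignedSelmerDualData` is the `ι`-twist -/

section EtaTwist

open PowerSeries Literature.NumberTheory.EllipticCurves Literature.NumberTheory.EllipticCurves.Module
  Literature.NumberTheory.EllipticCurves.Kobayashi2003 Literature.Barriers.BirchSwinnertonDyer
  SignedKatoOffTwo.IwasawaInvolution

variable {K : Type u} [Field K] [NumberField K] {p : ℕ} [Fact p.Prime]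
  {W : WeierstrassCurve K} {κ : ZpExtension K p} {K₀ : Type u} [Field K₀] [NumberField K₀]
  [Algebra K K₀] [(galRange (K := K) K₀).Normal] {E : Type u} [Field E] [Algebra K E]
  {η : Field.absoluteGaloisGroup K →* ℤˣ} {γ δ : Field.absoluteGaloisGroup K} {ε : ℤˣ}

section Abstract

variable (ι : IwasawaAlgebra p ≃+* IwasawaAlgebra p)
  (hι : ∀ f : IwasawaAlgebra p, ι f = subst (invOnePlusSubOne : ℤ_[p]⟦X⟧) f)
include hι

/-- **KEY COMPUTATION** in an `η`-datum `D : EtaSignedSelmerDualData W κ K₀ E η γ ε` (`T` acts as `x ↦ x ∘ conj_γ − x` on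
`Hom(Sel^ε(E/K_∞)^η, ℚ/ℤ)`): the unit `ι(1+T) = (1+T)⁻¹` acts as `x ↦ x ∘ conj_δ` for `γ δ = 1` (`conj_γ ∘ conj_δ = conj_1 = id`
on `H¹(K_∞, W[p^∞])`, `conjH1_mul`, `conjH1_one`; the `η`-component is `conj`-stable by
`conjH1_mem_towerSignedSelmerInftyEta`). The `η`-twin of bsd-wall's `toDual_invol_one_add_X_smul`. [folklore] -/
theorem eta_toDual_invol_one_add_X_smul (hγδ : γ * δ = 1) (D : EtaSignedSelmerDualData W κ K₀ E η γ ε) (x : D.X)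
    (s : towerSignedSelmerInftyEta W κ K₀ E η ε) :
    D.toDual (ι (1 + X) • x) s =
      D.toDual x ⟨W.conjH1 p (towerTopSubgroup κ K₀) δ s,
        conjH1_mem_towerSignedSelmerInftyEta W κ K₀ E η ε δ s.2⟩ := by
  set y : D.X := ι (1 + X) • x with hy
  have hx : x = (1 + X : IwasawaAlgebra p) • y := by
    rw [hy, ← mul_smul, one_add_X_mul_invol ι hι, one_smul]
  have h1 : ∀ s' : towerSignedSelmerInftyEta W κ K₀ E η ε, D.toDual ((1 + X : IwasawaAlgebra p) • y) s' =
      D.toDual y ⟨W.conjH1 p (towerTopSubgroup κ K₀) γ s', D.conj_mem _ s'.2⟩ := by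
    intro s'
    rw [add_smul, one_smul, map_add, AddMonoidHom.add_apply, D.toDual_T_smul, add_sub_cancel]
  conv_rhs => rw [hx, h1]
  congr 1
  apply Subtype.ext
  change (s : W.subgroupH1 p (towerTopSubgroup κ K₀)) =
    W.conjH1 p (towerTopSubgroup κ K₀) γ
      (W.conjH1 p (towerTopSubgroup κ K₀) δ (s : W.subgroupH1 p (towerTopSubgroup κ K₀)))
  rw [← AddMonoidHom.comp_apply, ← W.conjH1_mul_holds p (towerTopSubgroup κ K₀) γ δ, hγδ,
    W.conjH1_one_holds p (towerTopSubgroup κ K₀), AddMonoidHom.id_apply]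

/-- **THE η-TWIST `γ ↦ γ⁻¹` OF AN `η`-SIGNED DUAL DATUM IS ITS `ι`-TWIST.** For `γ δ = 1` and every pinned
`D : EtaSignedSelmerDualData W κ K₀ E η γ ε` there is `D′ : EtaSignedSelmerDualData W κ K₀ E η δ ε` on the SAME character
group (`D′.toDual ∘ e = D.toDual`) whose `Λ`-structure is the `ι`-twist: `e (f • x) = ι f • e x` (construction: `D′.X := D.X`,
`f •′ x := ι f • x`; `T •′ x = x ∘ conj_δ − x` by `eta_toDual_invol_one_add_X_smul`; constants are fixed by `ι`). In print
(Kobayashi Def. 2.1, (7.21); Kato §12.2) the dual carries the contragredient action, i.e. is the tree's `δ = γ⁻¹` datum.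
[cite: Kobayashi2003, Def. 2.1 (p. 5) and §4 p. 8 (the object X^±(E/K_∞)^η only)] [cite: Greenberg1989, pp. 101–102 (S^ι)] -/
theorem exists_twist_etaSignedSelmerDualData (hγδ : γ * δ = 1) (D : EtaSignedSelmerDualData W κ K₀ E η γ ε) :
    ∃ (D' : EtaSignedSelmerDualData W κ K₀ E η δ ε) (e : D.X ≃+ D'.X),
      (∀ (f : IwasawaAlgebra p) (x : D.X), e (f • x) = ι f • e x) ∧
      ∀ x : D.X, D'.toDual (e x) = D.toDual x := by
  have hmem : ∀ s ∈ towerSignedSelmerInftyEta W κ K₀ E η ε,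
      W.conjH1 p (towerTopSubgroup κ K₀) δ s ∈ towerSignedSelmerInftyEta W κ K₀ E η ε :=
    fun s hs ↦ conjH1_mem_towerSignedSelmerInftyEta W κ K₀ E η ε δ hs
  refine ⟨@EtaSignedSelmerDualData.mk K _ _ p _ W κ K₀ _ _ _ _ E _ _ η δ ε D.X D.addCommGroup
      (Module.compHom D.X (ι : IwasawaAlgebra p →+* IwasawaAlgebra p)) hmem D.toDual D.bijective ?_ ?_,
    AddEquiv.refl D.X, ?_, ?_⟩
  · intro x s
    change D.toDual (ι X • x) s = _
    rw [invol_X_eq_sub ι, sub_smul, one_smul, map_sub, AddMonoidHom.sub_apply,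
      eta_toDual_invol_one_add_X_smul ι hι hγδ D x s]
  · intro c x s k hk
    change D.toDual (ι (C c) • x) s = _
    rw [invol_C ι hι]
    exact D.toDual_C_smul c x s k hk
  · intro f x
    change f • x = ι (ι f) • x
    rw [invol_invol ι hι]
  · intro x
    rfl

/-- **The η-twisted datum and its invariants, packaged** (abstract `ι`): same character group, `Λ`-structure twisted by
`ι`, torsion ⟺ torsion, finite ⟺ finite, `char(D′.X) = ι(char(D.X))`, `ℓ_{ι𝔓}(D.X) = ℓ_𝔓(D′.X)`
(`SignedKatoOffTwo.SemilinearTransport`, §1). [folklore] -/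
theorem exists_twist_etaSignedSelmerDualData_invariants (hγδ : γ * δ = 1)
    (D : EtaSignedSelmerDualData W κ K₀ E η γ ε) :
    ∃ (D' : EtaSignedSelmerDualData W κ K₀ E η δ ε) (e : D.X ≃+ D'.X),
      (∀ (f : IwasawaAlgebra p) (x : D.X), e (f • x) = ι f • e x) ∧
      (∀ x : D.X, D'.toDual (e x) = D.toDual x) ∧
      (Module.IsTorsion (IwasawaAlgebra p) D.X ↔ Module.IsTorsion (IwasawaAlgebra p) D'.X) ∧
      (Module.Finite (IwasawaAlgebra p) D.X ↔ Module.Finite (IwasawaAlgebra p) D'.X) ∧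
      D'.charIdeal = D.charIdeal.map ι ∧
      ∀ 𝔓 : PrimeSpectrum (IwasawaAlgebra p),
        lengthAt (IwasawaAlgebra p) D.X ⟨𝔓.asIdeal.comap ι, inferInstance⟩ =
          lengthAt (IwasawaAlgebra p) D'.X 𝔓 := by
  obtain ⟨D', e, he, hdual⟩ := exists_twist_etaSignedSelmerDualData ι hι hγδ D
  exact ⟨D', e, he, hdual, SignedKatoOffTwo.SemilinearTransport.isTorsion_iff_of_semilinear ι e he,
    moduleFinite_iff_of_semilinear_equiv ι e he,
    SignedKatoOffTwo.SemilinearTransport.charIdeal_eq_map ι e he,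
    fun 𝔓 ↦ SignedKatoOffTwo.SemilinearTransport.lengthAt_eq ι e he rfl⟩

end Abstract

/-- **THE η-TWIST LEMMA in the tree's `IwasawaAlgebra.invol` currency** (sketch S2a `EtaTwistLemma` of the planner's kit):
for `γ δ = 1` and `D : Kobayashi2003.EtaSignedSelmerDualData W κ K₀ E η γ ε` there are `D′` over `δ` and `e : D.X ≃+ D′.X` with
`e (g • x) = IwasawaAlgebra.invol p g • e x`, `D′.toDual ∘ e = D.toDual`, torsion ⟺ torsion, finite ⟺ finite,
`D′.charIdeal = D.charIdeal.map (IwasawaAlgebra.invol p)`, `ℓ_{ι𝔓}(D.X) = ℓ_𝔓(D′.X)` (`ι𝔓 = PrimeSpectrum.comap (invol p) 𝔓`).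
[cite: Kobayashi2003, Def. 2.1 (p. 5) and §4 p. 8 (the object only)] [cite: Greenberg1989, pp. 101–102 (S^ι)] -/
theorem exists_twist_etaSignedSelmerDualData_invol (hγδ : γ * δ = 1) (D : EtaSignedSelmerDualData W κ K₀ E η γ ε) :
    ∃ (D' : EtaSignedSelmerDualData W κ K₀ E η δ ε) (e : D.X ≃+ D'.X),
      (∀ (g : IwasawaAlgebra p) (x : D.X), e (g • x) = IwasawaAlgebra.invol p g • e x) ∧
      (∀ x : D.X, D'.toDual (e x) = D.toDual x) ∧
      (Module.IsTorsion (IwasawaAlgebra p) D.X ↔ Module.IsTorsion (IwasawaAlgebra p) D'.X) ∧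
      (Module.Finite (IwasawaAlgebra p) D.X ↔ Module.Finite (IwasawaAlgebra p) D'.X) ∧
      D'.charIdeal = D.charIdeal.map (IwasawaAlgebra.invol p) ∧
      ∀ 𝔓 : PrimeSpectrum (IwasawaAlgebra p),
        lengthAt (IwasawaAlgebra p) D.X (PrimeSpectrum.comap (IwasawaAlgebra.invol p).toRingHom 𝔓) =
          lengthAt (IwasawaAlgebra p) D'.X 𝔓 := by
  obtain ⟨D', e, he, hdual, htors, hfin, hchar, hlen⟩ :=
    exists_twist_etaSignedSelmerDualData_invariants _ (involEquiv_eq_subst p) hγδ D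
  refine ⟨D', e, fun g x ↦ he g x, hdual, htors, hfin, ?_, fun 𝔓 ↦ ?_⟩
  · rw [hchar]
    rfl
  · rw [primeSpectrum_comap_invol_eq]
    exact hlen 𝔓

end EtaTwist

section InvolIdeal

open Literature.NumberTheory.EllipticCurves

variable (p : ℕ) [Fact p.Prime]

/-- `ι(I) = ι⁻¹(I)` for ideals of `Λ` (`Ideal.map` along the involution `IwasawaAlgebra.invol p` is `Ideal.comap`; `ι² = id`).
[folklore] -/
theorem ideal_map_invol_eq_comap (I : Ideal (IwasawaAlgebra p)) :
    I.map (IwasawaAlgebra.invol p) = I.comap (IwasawaAlgebra.invol p) := by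
  apply le_antisymm
  · rw [Ideal.map_le_iff_le_comap]
    intro x hx
    rw [Ideal.mem_comap, Ideal.mem_comap, IwasawaAlgebra.invol_invol]
    exact hx
  · intro x hx
    rw [Ideal.mem_comap] at hx
    rw [← IwasawaAlgebra.invol_invol p x]
    exact Ideal.mem_map_of_mem _ hx

/-- `ι(ι(I)) = I` for ideals of `Λ` (`ι² = id`). [folklore] -/
theorem ideal_map_invol_map_invol (I : Ideal (IwasawaAlgebra p)) :
    (I.map (IwasawaAlgebra.invol p)).map (IwasawaAlgebra.invol p) = I := by
  rw [ideal_map_invol_eq_comap, ideal_map_invol_eq_comap]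
  ext x
  rw [Ideal.mem_comap, Ideal.mem_comap, IwasawaAlgebra.invol_invol]

end InvolIdeal

end KatoSideIotaContra

end Summit.BirchSwinnertonDyer.BirchSwinnertonDyer.Theorems

end
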